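import Summits.CriticalPhenomena.PercolationContinuityZ3.Theorems.PercNearOneGluingNoHeavyPcintNawRandMem
import Summits.CriticalPhenomena.PercolationContinuityZ3.Theorems.PercNearOneGluingNoHeavyPcintChordMemBooking
import Summits.CriticalPhenomena.PercolationContinuityZ3.Theorems.PercNearOneGluingNoHeavyPcintChordRandWindowCert
import HarnessLib

/-!
# PCINT lane, reduction B3r (`chordrand_cw`) on the memory-`τ` DANGEROUS-SET automaton — the automaton and its soundness per step

Cell `prim-pcint` (PAPER-2 track (iii): certified intervals for `p_c(ℤ^d)`), seat `prim-pcint-2` (gen 4); support file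
(`--supports stmt-CriticalPhenomena-4575`).  Does NOT build on p205010.  Memo: `run/shared/lean/prim/pcint/REDUCTIONS.md`
§B3r.1–2, §B3r.6–8 (the B3r weight `chordRandWeight p s γ = pⁿ (1-p)^{#chords} s^{gapTotal γ} ((1+s)/2)^{cornerTotal γ}`
with `θ(p) ≤ Σ_{γ ∈ SAW_n} chordRandWeight p s γ` whenever `s² ≥ 1 - p²`, `…PcintChordRandReduction`).

This is the BOND twin of `…PcintNawRandMem` (prim-pcint-1 gen 5): the states are the dangerous sets of `…PcintMemAutomaton`
(`mstep τ`, `danger τ`, reused verbatim — a step is refused only when it lands ON a remembered site), decorated with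
* `bchord` — the DETECTED CHORDS: remembered sites adjacent to the new vertex (each pays `(1-p)·r`, `r` the refund);
* `bgap` — the DETECTED GAP SITES: lattice neighbours `w` of the new vertex other than the current endpoint and the
  remembered sites, adjacent to a remembered site of age `≥ 2` (gap `≥ 3`, on `ℤ^d` automatically `≥ 4`); each pays `s̄`;
* `bcorner` — the CLAIMED CORNER: the age-1 site is perpendicular to the step, the corner site is not remembered and has no
  remembered incidence of age `≥ 2`; pays `κ̄ ≥ (1+s̄)/2`;
and the weight `p · ((1-p) r)^{bchord} · s̄^{bgap} · κ̄^{[bcorner]}` (`chordMemAut`).  PROVED here (all `d`, all `τ ≥ 2`, no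
`sorry`): the run follows the dangerous sets (`mstep_danger_pre`), detected chords are remembered chords
(`bchord_le_remChordTrue`), detected gap sites off the path are genuine gap sites (`card_boff_le`, `card_boff_lt` for a claimed
corner that is neither on the path nor genuine), detected gap sites ON the path and an on-path claimed corner are on-path
events of `…PcintChordMemBooking` (`card_bon_le`), and the per-step domination `gapFactor_mul_le_bwt`.
The per-word assembly and the glue to `p ≤ p_c^bond(ℤ^d)` are in `…PcintChordMemSound`.
-/

noncomputable section

namespace Summit.CriticalPhenomena.PercolationContinuityZ3.Theorems.Pcint

open Finset Literature.Probability.Percolation Literature.Probability.LatticeModels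

variable {d : ℕ}

/-! ### The B3r automaton on dangerous-set states -/

/-- The DETECTED chords of a step: remembered sites adjacent to the new vertex (relative coordinates). [folklore] -/
def bchordSet (S : MState d) (a : Fin d × Bool) : Finset (Site d × ℕ) :=
  S.filter fun q => (zdGraph d).Adj q.1 (stepVec a)

/-- The detected chord count. [folklore] -/
def bchord (S : MState d) (a : Fin d × Bool) : ℕ := (bchordSet S a).card

/-- The DETECTED gap sites of a step (kind `chordrand`): lattice neighbours `w` of the new vertex, other than the current
endpoint `0` and the remembered sites, adjacent to a remembered site of age at least two. [folklore] -/
def bgapSet (S : MState d) (a : Fin d × Bool) : Finset (Site d) :=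
  (nbrSites (stepVec a)).filter fun w => w ≠ 0 ∧ (∀ q ∈ S, q.1 ≠ w) ∧ ∃ q ∈ S, 2 ≤ q.2 ∧ (zdGraph d).Adj q.1 w

/-- The detected gap count. [folklore] -/
def bgap (S : MState d) (a : Fin d × Bool) : ℕ := (bgapSet S a).card

/-- The detected gap count is at most `2d`. [folklore] -/
theorem bgap_le (S : MState d) (a : Fin d × Bool) : bgap S a ≤ 2 * d :=
  (card_filter_le _ _).trans (card_nbrSites_le _)

/-- The CLAIMED corner of a step (kind `chordrand`, as a Boolean): the remembered age-1 site `r₁` (the previous vertex) is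
perpendicular to the step, the corner site `r₁ + e` is not remembered, and no remembered site of age `≥ 2` is adjacent
to it. [folklore] -/
def bcorner (S : MState d) (a : Fin d × Bool) : Bool :=
  decide (∃ q₁ ∈ S, q₁.2 = 1 ∧ q₁.1 a.1 = 0 ∧ (∀ q ∈ S, q.1 ≠ q₁.1 + stepVec a) ∧
    ∀ q ∈ S, 2 ≤ q.2 → ¬ (zdGraph d).Adj q.1 (q₁.1 + stepVec a))

/-- The B3r step factor `((1-p) r)^{bchord} · s̄^{bgap} · κ̄^{[bcorner]}` (with `cr = (1-p)·r`). [folklore] -/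
def bwt (cr sb κb : ℝ) (S : MState d) (a : Fin d × Bool) : ℝ :=
  cr ^ bchord S a * (sb ^ bgap S a * (if bcorner S a then κb else 1))

/-- The step factor is nonnegative. [folklore] -/
theorem bwt_nonneg {cr sb κb : ℝ} (hcr : 0 ≤ cr) (hsb : 0 ≤ sb) (hκb : 0 ≤ κb) (S : MState d) (a : Fin d × Bool) :
    0 ≤ bwt cr sb κb S a := by
  unfold bwt; split_ifs <;> positivity

/-- **The B3r automaton on dangerous-set states** (memory `τ`): step `mstep τ`, weight
`p · ((1-p) r)^{bchord} · s̄^{bgap} · κ̄^{[bcorner]}`. [folklore] -/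
def chordMemAut (τ : ℕ) (p cr sb κb : ℝ) (hp : 0 ≤ p) (hcr : 0 ≤ cr) (hsb : 0 ≤ sb) (hκb : 0 ≤ κb) :
    WAut (MState d) (Fin d × Bool) where
  step := mstep τ
  wt S a := p * bwt cr sb κb S a
  wt_nonneg S a := mul_nonneg hp (bwt_nonneg hcr hsb hκb S a)

/-! ### Soundness along a self-avoiding word -/

section Sound

variable (a₀ : Fin d × Bool) {τ n : ℕ} {γ : Fin n → Fin d × Bool}

/-- **The run follows the dangerous sets**: along a self-avoiding word, reading letter `t` from the dangerous set of the
prefix of length `t` is accepted by `mstep` and yields the dangerous set of the prefix of length `t + 1`. [folklore] -/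
theorem mstep_danger_pre (hτ : 2 ≤ τ) (hs : IsSAW γ) {t : ℕ} (ht : t < n) :
    mstep τ (danger τ (pre a₀ γ t)) (γ ⟨t, ht⟩) = some (danger τ (pre a₀ γ (t + 1))) := by
  rw [← wordInit_pre a₀ γ t, ← pre_last a₀ γ ht]
  exact mstep_danger_wordInit hτ _ (isMem_of_isSAW τ (isSAW_pre a₀ hs (by omega)))

/-- Relative adjacency (seen from `v_t`) is absolute adjacency. [folklore] -/
theorem adj_sub_wordPos_iff {N : ℕ} (w : Fin N → Fin d × Bool) (t : ℕ) (x y : Site d) :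
    (zdGraph d).Adj (x - wordPos w t) (y - wordPos w t) ↔ (zdGraph d).Adj x y :=
  Literature.Probability.RandomPlanarGeometry.SAW.Zd.zdGraph_adj_sub_right _ _ _

/-- The step vector is the new vertex seen from the current one. [folklore] -/
theorem stepVec_eq_sub {t : ℕ} (ht : t < n) : stepVec (γ ⟨t, ht⟩) = wordPos γ (t + 1) - wordPos γ t := by
  rw [wordPos_succ γ ht]; abel

/-- A remembered site is an earlier vertex `v_{t-j}` that is remembered in the sense of `IsRem`. [folklore] -/
theorem isRem_of_mem_danger_pre {t : ℕ} (ht : t ≤ n) {q : Site d × ℕ} (hq : q ∈ danger τ (pre a₀ γ t)) :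
    q.2 ≤ t ∧ IsRem τ γ (t - q.2) t ∧ q.1 = wordPos γ (t - q.2) - wordPos γ t := by
  obtain ⟨h1, h2, h3, h4, h5⟩ := (mem_danger _ q).1 hq
  have hq1 : q.1 = wordPos γ (t - q.2) - wordPos γ t := by
    rw [h4, wordPos_pre a₀ γ ht (by omega), wordPos_pre a₀ γ ht le_rfl]
  refine ⟨h3, ⟨by omega, by omega, ?_⟩, hq1⟩
  rw [← hq1, show t - (t - q.2) = q.2 by omega]; exact h5

/-- Conversely, a remembered vertex gives an element of the dangerous set. [folklore] -/
theorem mem_danger_pre_of_isRem {t i : ℕ} (ht : t ≤ n) (h : IsRem τ γ i t) :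
    (wordPos γ i - wordPos γ t, t - i) ∈ danger τ (pre a₀ γ t) := by
  obtain ⟨h1, h2, h3⟩ := h
  refine (mem_danger _ _).2 ⟨by simp only; omega, by simp only; omega, by simp only; omega, ?_, ?_⟩
  · simp only
    rw [wordPos_pre a₀ γ ht (by omega), wordPos_pre a₀ γ ht le_rfl, show t - (t - i) = i by omega]
  · simpa using h3

/-- **Detected chords are remembered chords**: `bchord ≤ remChordTrue τ γ t`. [folklore] -/
theorem bchord_le_remChordTrue {t : ℕ} (ht : t < n) :
    bchord (danger τ (pre a₀ γ t)) (γ ⟨t, ht⟩) ≤ remChordTrue τ γ t := by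
  classical
  unfold bchord bchordSet remChordTrue
  refine Finset.card_le_card_of_injOn (fun q => t - q.2) (fun q hq => ?_) (fun q hq q' hq' h => ?_)
  · obtain ⟨hq, hadj⟩ := mem_filter.1 (mem_coe.1 hq)
    obtain ⟨hle, hrem, hq1⟩ := isRem_of_mem_danger_pre a₀ ht.le hq
    rw [mem_coe, mem_filter, mem_range]
    dsimp only
    refine ⟨by have := hrem.1; omega, hrem, ?_⟩
    rw [hq1, stepVec_eq_sub ht, adj_sub_wordPos_iff γ t] at hadj
    exact hadj
  · obtain ⟨hq, -⟩ := mem_filter.1 (mem_coe.1 hq)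
    obtain ⟨hq', -⟩ := mem_filter.1 (mem_coe.1 hq')
    obtain ⟨hle, -, hq1⟩ := isRem_of_mem_danger_pre a₀ ht.le hq
    obtain ⟨hle', -, hq1'⟩ := isRem_of_mem_danger_pre a₀ ht.le hq'
    have h2 : q.2 = q'.2 := by simp only at h; omega
    refine Prod.ext ?_ h2
    rw [hq1, hq1', h2]

/-- Translating a detected gap site that is off the path gives a genuine gap site at time `t + 1`. [folklore] -/
theorem mem_gapSet_of_bgap_off {t : ℕ} (ht : t < n) {w' : Site d}
    (hw' : w' ∈ bgapSet (danger τ (pre a₀ γ t)) (γ ⟨t, ht⟩)) (hoff : w' + wordPos γ t ∉ pathSites γ) :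
    w' + wordPos γ t ∈ gapSet γ (t + 1) := by
  rw [bgapSet, mem_filter, mem_nbrSites] at hw'
  obtain ⟨hadj, -, -, q, hq, hq2, hqw⟩ := hw'
  obtain ⟨hle, -, hq1⟩ := isRem_of_mem_danger_pre a₀ ht.le hq
  have hadj' : (zdGraph d).Adj (wordPos γ (t + 1)) (w' + wordPos γ t) := by
    rw [← adj_sub_wordPos_iff γ t, ← stepVec_eq_sub ht, add_sub_cancel_right]; exact hadj
  have hqw' : (zdGraph d).Adj (wordPos γ (t - q.2)) (w' + wordPos γ t) := by
    rw [← adj_sub_wordPos_iff γ t, ← hq1, add_sub_cancel_right]; exact hqw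
  exact mem_gapSet.2 ⟨hadj', hoff, t - q.2, by omega, hqw'⟩

/-- The off-path detected gap sites are at most the genuine gap sites. [folklore] -/
theorem card_boff_le {t : ℕ} (ht : t < n) :
    ((bgapSet (danger τ (pre a₀ γ t)) (γ ⟨t, ht⟩)).filter fun w' => w' + wordPos γ t ∉ pathSites γ).card ≤
      (gapSet γ (t + 1)).card :=
  Finset.card_le_card_of_injOn (fun w' => w' + wordPos γ t)
    (fun w' hw' => by
      obtain ⟨h1, h2⟩ := mem_filter.1 (mem_coe.1 hw')
      exact mem_coe.2 (mem_gapSet_of_bgap_off a₀ ht h1 h2))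
    (fun x _ y _ h => add_right_cancel h)

/-- What a claimed corner says along the word: `t ≥ 1`, the two steps are along different axes, the corner site
`cornerSite γ (t - 1) = v_{t-1} + e_t` is adjacent to `v_{t+1}` and to `v_{t-1}`, is not remembered (relative form), and no
remembered site of age `≥ 2` is adjacent to it. [folklore] -/
theorem bcorner_spec {t : ℕ} (ht : t < n) (hc : bcorner (danger τ (pre a₀ γ t)) (γ ⟨t, ht⟩) = true) :
    ∃ ht1 : 1 ≤ t, (γ ⟨t - 1, by omega⟩).1 ≠ (γ ⟨t, ht⟩).1 ∧
      cornerSite γ (t - 1) = wordPos γ (t - 1) + stepVec (γ ⟨t, ht⟩) ∧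
      (zdGraph d).Adj (wordPos γ (t + 1)) (cornerSite γ (t - 1)) ∧
      (zdGraph d).Adj (wordPos γ (t - 1)) (cornerSite γ (t - 1)) ∧
      cornerSite γ (t - 1) ≠ wordPos γ t ∧
      (∀ q ∈ danger τ (pre a₀ γ t), q.1 ≠ cornerSite γ (t - 1) - wordPos γ t) ∧
      (∀ q ∈ danger τ (pre a₀ γ t), 2 ≤ q.2 → ¬ (zdGraph d).Adj q.1 (cornerSite γ (t - 1) - wordPos γ t)) := by
  obtain ⟨q₁, hq₁, hage, hperp, hnot, hfree⟩ := of_decide_eq_true hc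
  obtain ⟨h2, -, hr₁⟩ := isRem_of_mem_danger_pre a₀ ht.le hq₁
  rw [hage] at h2 hr₁
  have ht1 : 1 ≤ t := h2
  have htm : t - 1 < n := by omega
  set e := stepVec (γ ⟨t, ht⟩) with he
  set s₁ := stepVec (γ ⟨t - 1, htm⟩) with hs₁
  have hprev : wordPos γ t = wordPos γ (t - 1) + s₁ := by
    conv_lhs => rw [show t = t - 1 + 1 by omega]
    exact wordPos_succ γ htm
  have hr₁' : q₁.1 = -s₁ := by rw [hr₁, hprev]; abel
  have hnext : wordPos γ (t + 1) = wordPos γ t + e := wordPos_succ γ ht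
  have hCdef : cornerSite γ (t - 1) = wordPos γ (t - 1) + e := by
    rw [cornerSite, dif_pos (show t - 1 + 1 < n by omega), he]
    congr 3; exact Fin.ext (by simp only; omega)
  have hCrel : cornerSite γ (t - 1) - wordPos γ t = q₁.1 + e := by rw [hCdef, hr₁]; abel
  have haxes : (γ ⟨t - 1, htm⟩).1 ≠ (γ ⟨t, ht⟩).1 := by
    intro hax
    have h0 : q₁.1 (γ ⟨t, ht⟩).1 = 0 := hperp
    rw [hr₁', Pi.neg_apply, ← hax, hs₁, stepVec_apply_fst] at h0
    revert h0; split_ifs <;> norm_num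
  refine ⟨ht1, haxes, hCdef, ?_, ?_, ?_, ?_, ?_⟩
  · have : cornerSite γ (t - 1) = wordPos γ (t + 1) - s₁ := by rw [hCdef, hnext, hprev]; abel
    rw [this, hs₁]; exact adj_sub_stepVec _ _
  · rw [hCdef, he, zdGraph_adj_iff_stepVec]; exact ⟨_, rfl⟩
  · intro hC
    apply haxes
    apply fst_eq_of_stepVec_eq
    rw [← hs₁, ← he]
    have := hC
    rw [hCdef, hprev] at this
    exact (add_left_cancel this).symm
  · intro q hq; rw [hCrel]; exact hnot q hq
  · intro q hq hq2; rw [hCrel]; exact hfree q hq hq2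

/-- **A claimed corner whose site is off the path but which is not a genuine corner hides an undetected genuine gap
site.** [folklore] -/
theorem card_boff_lt {t : ℕ} (ht : t < n) (hc : bcorner (danger τ (pre a₀ γ t)) (γ ⟨t, ht⟩) = true)
    (hcoff : cornerSite γ (t - 1) ∉ pathSites γ) (hnc : ¬ IsCorner γ (t - 1)) :
    ((bgapSet (danger τ (pre a₀ γ t)) (γ ⟨t, ht⟩)).filter fun w' => w' + wordPos γ t ∉ pathSites γ).card <
      (gapSet γ (t + 1)).card := by
  classical
  obtain ⟨ht1, haxes, hCdef, hC1, hC2, hCne, hnot, hfree⟩ := bcorner_spec a₀ ht hc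
  set C := cornerSite γ (t - 1) with hC
  -- since the claimed corner is not genuine, some vertex older than `v_{t-1}` is adjacent to `C`
  have hold : ∃ i, i < t - 1 ∧ (zdGraph d).Adj (wordPos γ i) C := by
    by_contra hno
    push Not at hno
    apply hnc
    refine ⟨by omega, ?_, hcoff, fun i hi => hno i (mem_range.1 hi)⟩
    have e1 : (⟨t - 1 + 1, by omega⟩ : Fin n) = ⟨t, ht⟩ := Fin.ext (by simp only; omega)
    rw [e1]; exact haxes
  obtain ⟨i, hi, hiC⟩ := hold
  have hCgap : C ∈ gapSet γ (t + 1) := mem_gapSet.2 ⟨hC1, hcoff, i, by omega, hiC⟩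
  set Woff := (bgapSet (danger τ (pre a₀ γ t)) (γ ⟨t, ht⟩)).filter fun w' => w' + wordPos γ t ∉ pathSites γ
    with hWoff
  have himg : Woff.image (fun w' => w' + wordPos γ t) ⊆ (gapSet γ (t + 1)).erase C := by
    intro x hx
    rw [mem_image] at hx
    obtain ⟨w', hw', rfl⟩ := hx
    obtain ⟨hw'1, hw'2⟩ := mem_filter.1 hw'
    refine mem_erase.2 ⟨fun hx => ?_, mem_gapSet_of_bgap_off a₀ ht hw'1 hw'2⟩
    rw [bgapSet, mem_filter] at hw'1
    obtain ⟨-, -, -, q, hq, hq2, hqw⟩ := hw'1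
    have hw'c : w' = C - wordPos γ t := by rw [← hx, add_sub_cancel_right]
    rw [hw'c] at hqw
    exact hfree q hq hq2 hqw
  calc Woff.card = (Woff.image fun w' => w' + wordPos γ t).card :=
        (card_image_of_injective _ (add_left_injective (wordPos γ t))).symm
    _ ≤ ((gapSet γ (t + 1)).erase C).card := card_le_card himg
    _ < (gapSet γ (t + 1)).card := card_erase_lt_of_mem hCgap

/-- **On-path charges are on-path events**: the detected gap sites at time `t` that are ON the path, plus the claimed corner
when its site is on the path, inject into the `t`-fibre of `onEventsR`. [folklore] -/
theorem card_bon_le (hτ : 2 ≤ τ) {t : ℕ} (ht : t < n) (cor : Bool)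
    (hcor : cor = true → bcorner (danger τ (pre a₀ γ t)) (γ ⟨t, ht⟩) = true ∧ cornerSite γ (t - 1) ∈ pathSites γ) :
    ((bgapSet (danger τ (pre a₀ γ t)) (γ ⟨t, ht⟩)).filter fun w' => w' + wordPos γ t ∈ pathSites γ).card +
        (if cor then 1 else 0) ≤ ((onEventsR τ γ).filter fun th => th.1 = t).card := by
  classical
  set Won := (bgapSet (danger τ (pre a₀ γ t)) (γ ⟨t, ht⟩)).filter fun w' => w' + wordPos γ t ∈ pathSites γ
    with hWon
  set S : Finset (Site d) := Won.image (fun w' => w' + wordPos γ t) ∪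
    (if cor then {cornerSite γ (t - 1)} else ∅) with hS
  -- every element of `S` is a path site adjacent to `v_{t+1}`, other than `v_t`, not remembered, with a remembered incidence
  have hSprop : ∀ x ∈ S, x ∈ pathSites γ ∧ (zdGraph d).Adj x (wordPos γ (t + 1)) ∧ x ≠ wordPos γ t ∧
      (∀ q ∈ danger τ (pre a₀ γ t), q.1 ≠ x - wordPos γ t) ∧
      ∃ i, i < t ∧ IsRem τ γ i t ∧ (zdGraph d).Adj (wordPos γ i) x := by
    intro x hx
    rw [hS, mem_union] at hx
    rcases hx with hx | hx
    · rw [mem_image] at hx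
      obtain ⟨w', hw', rfl⟩ := hx
      obtain ⟨hw'1, hon⟩ := mem_filter.1 hw'
      rw [bgapSet, mem_filter, mem_nbrSites] at hw'1
      obtain ⟨hadj, hw0, hnotin, q, hq, hq2, hqw⟩ := hw'1
      obtain ⟨hle, hrem, hq1⟩ := isRem_of_mem_danger_pre a₀ ht.le hq
      refine ⟨hon, ?_, fun hx => hw0 (by simpa using hx), fun q' hq' => by rw [add_sub_cancel_right]; exact hnotin q' hq',
        t - q.2, by omega, hrem, ?_⟩
      · rw [← adj_sub_wordPos_iff γ t, ← stepVec_eq_sub ht, add_sub_cancel_right]; exact hadj.symm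
      · rw [← adj_sub_wordPos_iff γ t, ← hq1, add_sub_cancel_right]; exact hqw
    · cases cor
      · simp at hx
      · rw [if_pos rfl, mem_singleton] at hx
        subst hx
        obtain ⟨hc, honc⟩ := hcor rfl
        obtain ⟨ht1, -, hCdef, hC1, hC2, hCne, hnot, -⟩ := bcorner_spec a₀ ht hc
        refine ⟨honc, hC1.symm, hCne, hnot, t - 1, by omega, ⟨by omega, by omega, ?_⟩, hC2⟩
        have hprev : wordPos γ t = wordPos γ (t - 1) + stepVec (γ ⟨t - 1, by omega⟩) := by
          conv_lhs => rw [show t = t - 1 + 1 by omega]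
          exact wordPos_succ γ (by omega)
        rw [show wordPos γ (t - 1) - wordPos γ t = -stepVec (γ ⟨t - 1, by omega⟩) by rw [hprev]; abel, l1_neg,
          l1_stepVec]
        omega
  have hcardS : S.card = Won.card + (if cor then 1 else 0) := by
    rw [hS, card_union_of_disjoint, card_image_of_injective _ (add_left_injective (wordPos γ t))]
    · cases cor
      · simp
      · rw [if_pos rfl, if_pos rfl, card_singleton]
    · cases cor
      · simp
      · rw [if_pos rfl, disjoint_singleton_right, mem_image]
        rintro ⟨w', hw', hwc⟩
        obtain ⟨hw'1, -⟩ := mem_filter.1 hw'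
        rw [bgapSet, mem_filter] at hw'1
        obtain ⟨-, -, -, q, hq, hq2, hqw⟩ := hw'1
        obtain ⟨hc, -⟩ := hcor rfl
        obtain ⟨-, -, -, -, -, -, -, hfree⟩ := bcorner_spec a₀ ht hc
        refine hfree q hq hq2 ?_
        rw [← hwc, add_sub_cancel_right]; exact hqw
  rw [← hcardS]
  refine Finset.card_le_card_of_injOn (fun x => (t, pathIdx γ x)) (fun x hx => ?_) (fun x hx y hy hxy => ?_)
  · obtain ⟨hxp, hadj, hne, hnotrem, i, hi, hir, hiadj⟩ := hSprop x (mem_coe.1 hx)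
    obtain ⟨hle, hpos⟩ := pathIdx_spec γ hxp
    rw [mem_coe, mem_filter, mem_onEventsR]
    refine ⟨⟨ht, hle, ?_, ?_, ?_, by rw [hpos]; exact hadj, i, hi, hir, by rw [hpos]; exact hiadj⟩, rfl⟩
    · intro hh; exact hne (hpos.symm.trans (congrArg (wordPos γ) hh))
    · intro hh
      have hx : x = wordPos γ (t + 1) := hpos.symm.trans (congrArg (wordPos γ) hh)
      rw [hx] at hadj; exact hadj.ne rfl
    · intro hrem
      have hmem := mem_danger_pre_of_isRem a₀ ht.le hrem
      exact hnotrem _ hmem (by simp only [hpos])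
  · have hx' := (pathIdx_spec γ (hSprop x (mem_coe.1 hx)).1).2
    have hy' := (pathIdx_spec γ (hSprop y (mem_coe.1 hy)).1).2
    rw [← hx', ← hy', (Prod.mk.inj hxy).2]

/-- **Per-step domination for kind `chordrand` on dangerous sets**: for a self-avoiding word, the full B3r factor at
time `t + 1` times `s^{#on-path events at t}` is at most the automaton's factor `s̄^{bgap} κ̄^{[bcorner]}` read from the
dangerous set of the prefix of length `t`, whenever `0 ≤ s ≤ s̄ ≤ 1` and `(1+s̄)/2 ≤ κ̄`. [folklore] -/
theorem gapFactor_mul_le_bwt (hτ : 2 ≤ τ) {t : ℕ} (ht : t < n)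
    {s sb κb : ℝ} (hs0 : 0 ≤ s) (hsb : s ≤ sb) (hsb1 : sb ≤ 1) (hκb : (1 + sb) / 2 ≤ κb) :
    gapFactor s ((1 + s) / 2) γ (t + 1) * s ^ ((onEventsR τ γ).filter fun th => th.1 = t).card ≤
      sb ^ bgap (danger τ (pre a₀ γ t)) (γ ⟨t, ht⟩) *
        (if bcorner (danger τ (pre a₀ γ t)) (γ ⟨t, ht⟩) then κb else 1) := by
  classical
  have hsb0 : 0 ≤ sb := hs0.trans hsb
  have hs1 : s ≤ 1 := hsb.trans hsb1
  have hsκ : s ≤ κb := by linarith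
  have hκ0 : (0 : ℝ) ≤ (1 + s) / 2 := by linarith
  have hκ1 : (1 + s) / 2 ≤ 1 := by linarith
  set W := bgapSet (danger τ (pre a₀ γ t)) (γ ⟨t, ht⟩) with hW
  set goff := (W.filter fun w' => w' + wordPos γ t ∉ pathSites γ).card with hgoff
  set gon := (W.filter fun w' => w' + wordPos γ t ∈ pathSites γ).card with hgon
  set e := ((onEventsR τ γ).filter fun th => th.1 = t).card with he
  have hsplit : bgap (danger τ (pre a₀ γ t)) (γ ⟨t, ht⟩) = gon + goff := by
    unfold bgap
    rw [hgon, hgoff, hW]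
    exact (Finset.card_filter_add_card_filter_not _).symm
  have hgoff_le : goff ≤ (gapSet γ (t + 1)).card := card_boff_le a₀ ht
  have hgon_le : gon ≤ e := by
    have := card_bon_le (γ := γ) a₀ hτ ht false (fun h => Bool.noConfusion h)
    simpa using this
  have hpow_g : s ^ (gapSet γ (t + 1)).card ≤ s ^ goff := pow_le_pow_of_le_one hs0 hs1 hgoff_le
  have hpow_e : s ^ e ≤ s ^ gon := pow_le_pow_of_le_one hs0 hs1 hgon_le
  have hwin : s ^ goff * s ^ gon ≤ sb ^ bgap (danger τ (pre a₀ γ t)) (γ ⟨t, ht⟩) := by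
    rw [← pow_add, show goff + gon = gon + goff by ring, ← hsplit]
    exact pow_le_pow_left₀ hs0 hsb _
  have hgf0 : 0 ≤ s ^ (gapSet γ (t + 1)).card := pow_nonneg hs0 _
  unfold gapFactor
  rw [show t + 1 - 2 = t - 1 by omega]
  have h1 : s ^ (gapSet γ (t + 1)).card * (if 2 ≤ t + 1 ∧ IsCorner γ (t - 1) then (1 + s) / 2 else 1)
      ≤ s ^ goff := by
    split_ifs
    · exact (mul_le_of_le_one_right hgf0 hκ1).trans hpow_g
    · rw [mul_one]; exact hpow_g
  have hbase : s ^ (gapSet γ (t + 1)).card * (if 2 ≤ t + 1 ∧ IsCorner γ (t - 1) then (1 + s) / 2 else 1)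
      * s ^ e ≤ s ^ goff * s ^ gon :=
    mul_le_mul h1 hpow_e (pow_nonneg hs0 _) (pow_nonneg hs0 _)
  cases hcb : bcorner (danger τ (pre a₀ γ t)) (γ ⟨t, ht⟩)
  · simp only [Bool.false_eq_true, if_false, mul_one]
    exact hbase.trans hwin
  · simp only [if_true]
    by_cases hcon : cornerSite γ (t - 1) ∈ pathSites γ
    · -- corner site on the path: one more on-path event pays the coin
      have hgon1 : gon + 1 ≤ e := by
        have := card_bon_le (γ := γ) a₀ hτ ht true (fun _ => ⟨hcb, hcon⟩)
        simpa using this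
      calc _ ≤ s ^ goff * s ^ (gon + 1) :=
            mul_le_mul h1 (pow_le_pow_of_le_one hs0 hs1 hgon1) (pow_nonneg hs0 _) (pow_nonneg hs0 _)
        _ = s ^ goff * s ^ gon * s := by rw [pow_succ]; ring
        _ ≤ sb ^ bgap (danger τ (pre a₀ γ t)) (γ ⟨t, ht⟩) * κb := mul_le_mul hwin hsκ hs0 (pow_nonneg hsb0 _)
    · obtain ⟨ht1, -⟩ := bcorner_spec a₀ ht hcb
      by_cases hcor : IsCorner γ (t - 1)
      · rw [if_pos ⟨by omega, hcor⟩]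
        calc s ^ (gapSet γ (t + 1)).card * ((1 + s) / 2) * s ^ e
            = s ^ (gapSet γ (t + 1)).card * s ^ e * ((1 + s) / 2) := by ring
          _ ≤ s ^ goff * s ^ gon * κb :=
              mul_le_mul (mul_le_mul hpow_g hpow_e (pow_nonneg hs0 _) (pow_nonneg hs0 _)) (by linarith) hκ0
                (mul_nonneg (pow_nonneg hs0 _) (pow_nonneg hs0 _))
          _ ≤ sb ^ bgap (danger τ (pre a₀ γ t)) (γ ⟨t, ht⟩) * κb := mul_le_mul_of_nonneg_right hwin (by linarith)
      · rw [if_neg (fun h => hcor h.2), mul_one]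
        have hlt : goff < (gapSet γ (t + 1)).card := by
          rw [hgoff, hW]; exact card_boff_lt a₀ ht hcb hcon hcor
        calc s ^ (gapSet γ (t + 1)).card * s ^ e ≤ s ^ (goff + 1) * s ^ gon :=
              mul_le_mul (pow_le_pow_of_le_one hs0 hs1 (by omega)) hpow_e (pow_nonneg hs0 _) (pow_nonneg hs0 _)
          _ = s ^ goff * s ^ gon * s := by rw [pow_succ]; ring
          _ ≤ sb ^ bgap (danger τ (pre a₀ γ t)) (γ ⟨t, ht⟩) * κb := mul_le_mul hwin hsκ hs0 (pow_nonneg hsb0 _)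

end Sound

end Summit.CriticalPhenomena.PercolationContinuityZ3.Theorems.Pcint
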